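import Summits.CriticalPhenomena.SAWScalingLimit.Theses.SAWTurnDefect
import Literature.Probability.RandomPlanarGeometry.HexFlowLineObservable

/-!
# Crux `HexFlowLineMartingale` (stmt-CriticalPhenomena-7891) — birth skeleton `Lines/birth.lean`

Route `route-CriticalPhenomena-SAWTurnDefect`, sub-problem `SAWScalingLimit`, crux rank 2 (KC): there is
a bank constant `l` such that the imaginary-geometry harmonic observable `t ↦ M_t(x_δ)` of the critical
hexagonal SAW, stopped at `T` (tip `ρ`-close to `z₀` or `b`), is an `L¹`-approximate martingale against
every event on the first `k` steps, uniformly in `k ≤ m`, as `δ → 0⁺`.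

All statements below are written in the vocabulary of
`Literature/Probability/RandomPlanarGeometry/HexFlowLineObservable.lean`, whose definitions were made
to unfold (`δ/ζ`) to the `let`s of the filed signature: `γ.igObservable φ l χ t y` = the `let M`,
`γ.stopIndex z₀ (D.pt 1) ρ` = the `let T`, `γ.bank t` = `let B`, `γ.igData` = `let dat`,
`hexInterior` = `let Hex`; `γ.tipHexagon t` = the hexagon `v_t` ahead of the tip,
`γ.tipHarmonicMeasure t y = ω^y_t(v_t)`.  (Checked here: `crux_iff_named` is `Iff.rfl`.)

## The line: DefectIdentity summed along the walk ⇒ the kernel comparison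

The route header: "By DefectIdentity the left side telescopes into the expectation of
`Σ_t ω_t(v_t)(f_{R,t} − f_{L,t})(𝟙[left turn] − p^THE_t)·𝟙_E`: the kernel comparison."  Cut at its
seams this is three lemmas.

* `stub_defectStep` — ONE-STEP DEFECT IDENTITY ALONG THE WALK (Schramm–Sheffield's martingale
  mechanism, Lemma 3.1 of arXiv:math/0310210, run for an ARBITRARY hexagonal path; the route's support
  item `DefectIdentity` at `p ∈ {0,1}` plus the honeycomb bookkeeping): for `1 ≤ t < |γ|`,
  `M_{t+1}(y) − M_t(y) = 𝟙[v_t ∉ bank_t] · ω^y_t(v_t) · (igData_{t+1}(v_t) − M_t(v_t))`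
  — exactly one hexagon `v_t` (the one ahead of the tip) is determined at step `t ≥ 1`
  (`bank_{t+1} ∖ bank_t ⊆ {v_t}`), its datum is frozen from then on, and the first-passage
  decomposition of the walk sum `hexHarmonicExt` at `v_t` (summability: total mass `≤ 1`, finitely many
  data values) gives the product.  Since `M_t(v_t) = p^THE_t f_R + (1 − p^THE_t) f_L`
  (`hexTiltedProb_combination`) and the new datum is `f_R` on a left turn, `f_L` on a right turn, the
  right-hand side IS `ω_t(v_t)(f_R − f_L)(𝟙[left] − p^THE_t)` whenever `f_R ≠ f_L`: the defect is
  written here without the auxiliary candidate data, so no division and no hypothetical continuation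
  enters the signature.  Size M/L (triangular-lattice walk sums with `tsum`, `hexFaceVertices`
  incidences `|hf γ_t ∩ hf γ_{t±1}| = 2`, contact hexagons contribute `0`).  Why it might fail as typed:
  only through a convention slip (it is an identity of finite path sums); `t = 0` is excluded on purpose
  (the first dart flanks TWO new hexagons at `a_δ`) and `t < |γ|` is necessary (at `t = |γ|` the left
  side is `0`, the right side is not).
* `stub_firstStep` — THE FIRST STEP IS INVISIBLE FROM THE INTERIOR (2D potential theory, sure bound):
  `|M_{1∧T}(x_δ) − M_0(x_δ)| ≤ ε` for ALL walks once `δ` is small: the step `0 → 1` re-colours at most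
  the two hexagons flanking the first dart at `a_δ` (data jump `≤ |l| + 2`), and the harmonic measure
  from `x_δ → z₀ ∈ Ω` of a single hexagon at macroscopic distance, inside a bounded domain, is
  `O(1/log(1/δ))` (potential-kernel / Green's-function asymptotics of the planar walk, Lawler–Limic
  §4.4, §6.3; not in the tree).  Size M/L.  Why it might fail: it does not as a statement (uniform in
  `γ`: at time `0` the absorbing set does not depend on `γ` beyond the `≤ 3` hexagons at `a_δ`); the
  risk is only library depth (no planar potential kernel in Mathlib).
* `stub_kernelComparison` — THE KERNEL COMPARISON (load-bearing, open; the TRANSFER of the crux to the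
  variables the route's two-layer plan attacks): `∃ l` such that, eventually in `δ`, for `1 ≤ k ≤ m` and
  every event `E` on the first `k` steps,
  `|E[ Σ_{t ∈ [k∧T, m∧T)} 𝟙[v_t ∉ bank_t] ω^{x_δ}_t(v_t)(igData_{t+1}(v_t) − M_t(v_t)) · 𝟙_E ]| ≤ ε`,
  i.e. `|E[Σ_t ω_t(v_t)(f_R − f_L)(𝟙[left] − p^THE_t) 𝟙_E]| ≤ ε` — the harmonic-measure-weighted
  cumulative discrepancy between the polymer's turns and the tilted-harmonic-explorer kernel has
  vanishing expectation.  WHY EASIER than the crux as filed: the harmonic-extension observable at the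
  far point is gone; what is left is a sum over tip times of (harmonic measure of ONE hexagon) ×
  (a tip-local datum minus the explorer's prediction), which is what `TipPatternEquilibrium` (rank 4),
  `KernelOrthogonality` (stmt-8295) and the foreseen `TailDecay` decompose (boundary-Harnack
  factorisation `ω^z_t(v_t) = Ω^z_t · ℓ^{(r)}_t (1 + o_r(1))`, pattern frequencies, Beurling tail).
  Why it might fail: exactly the crux's risk (a convention-induced angle bias of the frozen bank data
  not absorbable in `l`; `Σ_t ω_t ≍ δ^{-2/3}` forces the pattern-averaged orthogonality to be exact).

* `approxMartingale_of_telescoping` — the ANALYTIC COMPOSITION, proved here in the abstract (any finite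
  measure of mass `≤ 1` on a discrete space): telescoping over `[k∧T, m∧T)`, the `k = 0` case split off
  at the first step (event on `0` steps = event on `1` step via `List.take_take`), `ε/2 + ε/2` with the
  non-integrable case handled by `integral_undef`.
* `stubComposition : StubComposition` — the three stub signatures, verbatim, imply the crux
  `…Theses.SAWTurnDefect.HexFlowLineMartingale` BY NAME (kernel-checked, no `sorry`), and
  `HexFlowLineMartingale_of : HexFlowLineMartingale` — the crux from the three stubs BY NAME.

Disproof used: none on file (`ledger crux ls stmt-CriticalPhenomena-7891`: no workfiles, no
`Disproof.lean`, no `Theorems/HexFlowLineMartingale/Negative/` at registration, 2026-08-17).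
Negatives index respected: nothing here asserts all-`δ` tightness (stmt-0772) or any refuted statement;
the stubs quantify `∀ᶠ δ` exactly as the crux.
-/

namespace Summit.CriticalPhenomena.SAWScalingLimit.Cruxes.HexFlowLineMartingale.Birth

open scoped Topology
open MeasureTheory Filter
open Literature.Probability.RandomPlanarGeometry Literature.Probability.LatticeModels

/-! ### The crux in named vocabulary (definitional check) -/

/-- The filed crux IS, definitionally (`Iff.rfl`), its restatement with the named definitions of
`HexFlowLineObservable.lean` (`χ = 2/(3π)`): the `let`s of the route decl `ζ/δ`-reduce to
`igObservable`, `stopIndex`, … .  (A check only; nothing below depends on it.) -/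
theorem crux_iff_named :
    Summit.CriticalPhenomena.SAWScalingLimit.Theses.SAWTurnDefect.HexFlowLineMartingale ↔
    (∃ l : ℝ, ∀ (D : DobrushinDomain) (a b : ℝ → HexVertex)
      (φ : ConformalEquiv UpperHalfPlane.upperHalfPlaneSet D.carrier) (z₀ : ℂ) (x : ℝ → Site 2),
      SAW.IsEmbEndpointApprox hexGraph hexCenter D a b → D.IsChordalUniformizing φ → z₀ ∈ D.carrier →
      Tendsto (fun δ : ℝ => (δ : ℂ) * triEmbed (x δ)) (𝓝[>] 0) (𝓝 z₀) →
      ∀ ρ ε : ℝ, 0 < ρ → 0 < ε → ∀ᶠ δ : ℝ in 𝓝[>] 0,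
        ∀ k m : ℕ, k ≤ m → ∀ E : Set (List HexVertex),
          |∫ γ, ((γ : SAW.HexDomainSAW D.carrier δ (a δ) (b δ)).igObservable φ l (2 / (3 * Real.pi))
                  (min m (γ.stopIndex z₀ (D.pt 1) ρ)) (x δ)
                - γ.igObservable φ l (2 / (3 * Real.pi)) (min k (γ.stopIndex z₀ (D.pt 1) ρ)) (x δ))
              * E.indicator (fun _ => (1 : ℝ)) (γ.walk.support.take (k + 1))
            ∂(SAW.hexSAWLaw D.carrier δ (a δ) (b δ))| ≤ ε) :=
  Iff.rfl

/-! ### The three stubs -/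

/-- STUB 1 (one-step defect identity along the walk; M/L): for a hexagonal SAW `γ` of `Ω_δ`, a
uniformizer `φ`, constants `l, χ`, a step `1 ≤ t < |γ|` and any hexagon `y`,
`M_{t+1}(y) − M_t(y) = 𝟙[v_t ∉ bank_t] · ω^y_t(v_t) · (igData_{t+1}(v_t) − M_t(v_t))`, `v_t` the hexagon
ahead of the tip (`tipHexagon`), `ω^y_t(v_t)` its harmonic measure from `y` in the undetermined region
(`tipHarmonicMeasure`).  Schramm–Sheffield Lemma 3.1 for an arbitrary path = the route's `DefectIdentity`
at `p ∈ {0, 1}` + `bank_{t+1} ∖ bank_t ⊆ {v_t}` + frozen data + first-passage decomposition of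
`hexHarmonicExt` (summable: mass `≤ 1`). [SchrammSheffield2005 §3.1, Lemma 3.1; LawlerLimic2010 §6.2] -/
theorem stub_defectStep :
    ∀ (Ω : Set ℂ) (δ : ℝ) (a b : Literature.Probability.LatticeModels.HexVertex)
      (γ : Literature.Probability.RandomPlanarGeometry.SAW.HexDomainSAW Ω δ a b)
      (φ : Literature.Probability.RandomPlanarGeometry.ConformalEquiv UpperHalfPlane.upperHalfPlaneSet Ω)
      (l χ : ℝ) (t : ℕ) (y : Literature.Probability.LatticeModels.Site 2),
      1 ≤ t → t + 1 ≤ γ.walk.length →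
        γ.igObservable φ l χ (t + 1) y - γ.igObservable φ l χ t y =
          (γ.bank t)ᶜ.indicator (fun _ => (1 : ℝ)) (γ.tipHexagon t) *
            (γ.tipHarmonicMeasure t y *
              (γ.igData φ l χ (t + 1) (γ.tipHexagon t) - γ.igObservable φ l χ t (γ.tipHexagon t))) := by
  sorry

/-- STUB 2 (the first step is invisible from the interior; M/L, planar potential theory): for every
bank constant `l`, Dobrushin domain, hexagonal endpoint approximation, uniformizer, interior point
`z₀` with hexagons `x_δ → z₀`, and `ρ, ε > 0`: for all small `δ` and EVERY SAW `γ` of `Ω_δ`,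
`|M_{1∧T}(x_δ) − M_0(x_δ)| ≤ ε` — the step `0 → 1` re-colours at most the two hexagons flanking the
first dart at `a_δ` (bounded data jump), whose harmonic measure from a macroscopically distant point in a
bounded domain is `O(1/log(1/δ))`. [LawlerLimic2010 §4.4 (potential kernel), §6.3; SchrammSheffield2005 §3.1] -/
theorem stub_firstStep :
    ∀ (l : ℝ) (D : Literature.Probability.RandomPlanarGeometry.DobrushinDomain)
      (a b : ℝ → Literature.Probability.LatticeModels.HexVertex)
      (φ : Literature.Probability.RandomPlanarGeometry.ConformalEquiv UpperHalfPlane.upperHalfPlaneSet D.carrier)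
      (z₀ : ℂ) (x : ℝ → Literature.Probability.LatticeModels.Site 2),
      Literature.Probability.RandomPlanarGeometry.SAW.IsEmbEndpointApprox
          Literature.Probability.LatticeModels.hexGraph Literature.Probability.LatticeModels.hexCenter D a b →
      D.IsChordalUniformizing φ → z₀ ∈ D.carrier →
      Filter.Tendsto (fun δ : ℝ => (δ : ℂ) * Literature.Probability.LatticeModels.triEmbed (x δ))
        (nhdsWithin 0 (Set.Ioi 0)) (nhds z₀) →
      ∀ ρ ε : ℝ, 0 < ρ → 0 < ε → ∀ᶠ δ : ℝ in nhdsWithin 0 (Set.Ioi 0),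
        ∀ γ : Literature.Probability.RandomPlanarGeometry.SAW.HexDomainSAW D.carrier δ (a δ) (b δ),
          |γ.igObservable φ l (2 / (3 * Real.pi)) (min 1 (γ.stopIndex z₀ (D.pt 1) ρ)) (x δ)
            - γ.igObservable φ l (2 / (3 * Real.pi)) 0 (x δ)| ≤ ε := by
  sorry

/-- STUB 3 (the kernel comparison; load-bearing, open — the crux transferred to defect variables):
there is a bank constant `l` such that for every Dobrushin domain, hexagonal endpoint approximation,
chordal uniformizer `φ`, interior point `z₀` with hexagons `x_δ → z₀`, and `ρ, ε > 0`, for all small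
`δ`: for `1 ≤ k ≤ m` and every event `E` on the first `k` steps,
`|E[ Σ_{t ∈ [k∧T, m∧T)} 𝟙[v_t ∉ bank_t] · ω^{x_δ}_t(v_t) · (igData_{t+1}(v_t) − M_t(v_t)) · 𝟙_E ]| ≤ ε`.
By `hexTiltedProb_combination` the summand equals `ω_t(v_t)(f_{R,t} − f_{L,t})(𝟙[γ turns left at t] −
p^THE_t)`: the harmonic-measure-weighted cumulative discrepancy between the SAW's turns and the
tilted-harmonic-explorer kernel is invisible in expectation (route § Thesis (KC), card
turn-defect-kernel-orthogonality).  Attacked by the route's layer 2 (`TipPatternEquilibrium`,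
`KernelOrthogonality`, `TailDecay`). [SchrammSheffield2005; MillerSheffield2016 Thm 1.1; MadrasSlade1993 §7.4] -/
theorem stub_kernelComparison :
    ∃ l : ℝ, ∀ (D : Literature.Probability.RandomPlanarGeometry.DobrushinDomain)
      (a b : ℝ → Literature.Probability.LatticeModels.HexVertex)
      (φ : Literature.Probability.RandomPlanarGeometry.ConformalEquiv UpperHalfPlane.upperHalfPlaneSet D.carrier)
      (z₀ : ℂ) (x : ℝ → Literature.Probability.LatticeModels.Site 2),
      Literature.Probability.RandomPlanarGeometry.SAW.IsEmbEndpointApprox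
          Literature.Probability.LatticeModels.hexGraph Literature.Probability.LatticeModels.hexCenter D a b →
      D.IsChordalUniformizing φ → z₀ ∈ D.carrier →
      Filter.Tendsto (fun δ : ℝ => (δ : ℂ) * Literature.Probability.LatticeModels.triEmbed (x δ))
        (nhdsWithin 0 (Set.Ioi 0)) (nhds z₀) →
      ∀ ρ ε : ℝ, 0 < ρ → 0 < ε → ∀ᶠ δ : ℝ in nhdsWithin 0 (Set.Ioi 0),
        ∀ k m : ℕ, 1 ≤ k → k ≤ m → ∀ E : Set (List Literature.Probability.LatticeModels.HexVertex),
          |∫ γ, (∑ t ∈ Finset.Ico (min k (γ.stopIndex z₀ (D.pt 1) ρ)) (min m (γ.stopIndex z₀ (D.pt 1) ρ)),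
                  (γ.bank t)ᶜ.indicator (fun _ => (1 : ℝ)) (γ.tipHexagon t) *
                    (γ.tipHarmonicMeasure t (x δ) *
                      (γ.igData φ l (2 / (3 * Real.pi)) (t + 1) (γ.tipHexagon t)
                        - γ.igObservable φ l (2 / (3 * Real.pi)) t (γ.tipHexagon t))))
              * E.indicator (fun _ => (1 : ℝ)) (γ.walk.support.take (k + 1))
            ∂(Literature.Probability.RandomPlanarGeometry.SAW.hexSAWLaw D.carrier δ (a δ) (b δ))| ≤ ε := by
  sorry

/-! ### The analytic composition, in the abstract -/

/-- Telescoping + first-step split: on a measure space of mass `≤ 1` where every real function is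
measurable, if `X_{t+1} − X_t = Δ_t` for `1 ≤ t < T`, the first increment `X_{1∧T} − X_0` is surely
`≤ ε/2`, and the `Δ`-sums over `[k∧T, m∧T)` have expectation `≤ ε/2` against every event on the first
`k ≥ 1` observations, then `X` stopped at `T` is an `ε`-approximate martingale against events on the first
`k ≥ 0` observations. [folklore] -/
theorem approxMartingale_of_telescoping {Γ α : Type*} [MeasurableSpace Γ] (μ : Measure Γ)
    [IsFiniteMeasure μ] (hμ : μ Set.univ ≤ 1) (hmeas : ∀ f : Γ → ℝ, Measurable f)
    (pfx : Γ → List α) (X Δ : Γ → ℕ → ℝ) (T : Γ → ℕ) {ε : ℝ} (hε : 0 ≤ ε)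
    (hstep : ∀ γ t, 1 ≤ t → t < T γ → X γ (t + 1) - X γ t = Δ γ t)
    (hfirst : ∀ γ, |X γ (min 1 (T γ)) - X γ 0| ≤ ε / 2)
    (hsum : ∀ k m : ℕ, 1 ≤ k → k ≤ m → ∀ E : Set (List α),
      |∫ γ, (∑ t ∈ Finset.Ico (min k (T γ)) (min m (T γ)), Δ γ t) *
          E.indicator (fun _ => (1 : ℝ)) ((pfx γ).take (k + 1)) ∂μ| ≤ ε / 2) :
    ∀ k m : ℕ, k ≤ m → ∀ E : Set (List α),
      |∫ γ, (X γ (min m (T γ)) - X γ (min k (T γ))) *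
          E.indicator (fun _ => (1 : ℝ)) ((pfx γ).take (k + 1)) ∂μ| ≤ ε := by
  -- pointwise telescoping, for `1 ≤ k ≤ m`
  have tele : ∀ γ (k m : ℕ), 1 ≤ k → k ≤ m →
      X γ (min m (T γ)) - X γ (min k (T γ)) =
        ∑ t ∈ Finset.Ico (min k (T γ)) (min m (T γ)), Δ γ t := by
    intro γ k m hk hkm
    have hle : min k (T γ) ≤ min m (T γ) := min_le_min_right (T γ) hkm
    rw [← Finset.sum_Ico_sub (X γ) hle]
    refine Finset.sum_congr rfl fun t ht => ?_
    rw [Finset.mem_Ico] at ht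
    have htT : t < T γ := lt_of_lt_of_le ht.2 (min_le_right _ _)
    have h1T : 1 ≤ T γ := Nat.succ_le_of_lt (lt_of_le_of_lt (Nat.zero_le t) htT)
    exact hstep γ t (le_trans (le_min hk h1T) ht.1) htT
  have hreal : μ.real Set.univ ≤ 1 := by
    rw [measureReal_def]
    have h := ENNReal.toReal_mono ENNReal.one_ne_top hμ
    simpa using h
  intro k m hkm E
  rcases Nat.eq_zero_or_pos k with rfl | hk
  · -- `k = 0`: split off the first step
    rcases Nat.eq_zero_or_pos m with rfl | hm
    · simp [hε]
    · -- an event on the first `0` steps is an event on the first `1` step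
      let E' : Set (List α) := {L | L.take 1 ∈ E}
      have hind : ∀ γ, E.indicator (fun _ => (1 : ℝ)) ((pfx γ).take (0 + 1)) =
          E'.indicator (fun _ => (1 : ℝ)) ((pfx γ).take (1 + 1)) := by
        intro γ
        have hmem : (pfx γ).take (1 + 1) ∈ E' ↔ (pfx γ).take (0 + 1) ∈ E := by
          show ((pfx γ).take (1 + 1)).take 1 ∈ E ↔ (pfx γ).take (0 + 1) ∈ E
          rw [List.take_take]
          norm_num
        by_cases h : (pfx γ).take (0 + 1) ∈ E
        · rw [Set.indicator_of_mem h, Set.indicator_of_mem (hmem.2 h)]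
        · rw [Set.indicator_of_notMem h, Set.indicator_of_notMem (fun h' => h (hmem.1 h'))]
      -- the two pieces
      let A : Γ → ℝ := fun γ => (∑ t ∈ Finset.Ico (min 1 (T γ)) (min m (T γ)), Δ γ t) *
        E'.indicator (fun _ => (1 : ℝ)) ((pfx γ).take (1 + 1))
      let r : Γ → ℝ := fun γ => (X γ (min 1 (T γ)) - X γ 0) *
        E.indicator (fun _ => (1 : ℝ)) ((pfx γ).take (0 + 1))
      have hdecomp : (fun γ => (X γ (min m (T γ)) - X γ (min 0 (T γ))) *
          E.indicator (fun _ => (1 : ℝ)) ((pfx γ).take (0 + 1))) = fun γ => A γ + r γ := by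
        funext γ
        simp only [A, r]
        rw [← tele γ 1 m le_rfl hm, ← hind γ, Nat.zero_min]
        ring
      have hr_bound : ∀ γ, ‖r γ‖ ≤ ε / 2 := by
        intro γ
        simp only [r]
        rw [Real.norm_eq_abs, abs_mul]
        have hi : |E.indicator (fun _ => (1 : ℝ)) ((pfx γ).take (0 + 1))| ≤ 1 := by
          by_cases h : (pfx γ).take (0 + 1) ∈ E
          · rw [Set.indicator_of_mem h]; simp
          · rw [Set.indicator_of_notMem h]; simp
        calc |X γ (min 1 (T γ)) - X γ 0| * |E.indicator (fun _ => (1 : ℝ)) ((pfx γ).take (0 + 1))|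
            ≤ ε / 2 * 1 := mul_le_mul (hfirst γ) hi (abs_nonneg _) (by linarith)
          _ = ε / 2 := mul_one _
      have hr_int : Integrable r μ :=
        (integrable_const (ε / 2)).mono' (hmeas r).aestronglyMeasurable (Eventually.of_forall hr_bound)
      have hr_le : |∫ γ, r γ ∂μ| ≤ ε / 2 := by
        have h := norm_integral_le_of_norm_le_const (μ := μ) (Eventually.of_forall hr_bound)
        rw [Real.norm_eq_abs] at h
        refine h.trans ?_
        have hε2 : 0 ≤ ε / 2 := by linarith
        calc ε / 2 * μ.real Set.univ ≤ ε / 2 * 1 :=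
            mul_le_mul_of_nonneg_left hreal hε2
          _ = ε / 2 := mul_one _
      rw [hdecomp]
      by_cases hAi : Integrable A μ
      · rw [integral_add hAi hr_int]
        calc |∫ γ, A γ ∂μ + ∫ γ, r γ ∂μ| ≤ |∫ γ, A γ ∂μ| + |∫ γ, r γ ∂μ| := abs_add_le _ _
          _ ≤ ε / 2 + ε / 2 := add_le_add (hsum 1 m le_rfl hm E') hr_le
          _ = ε := by ring
      · have hnot : ¬ Integrable (fun γ => A γ + r γ) μ := by
          intro h
          apply hAi
          have hA : A = fun γ => (A γ + r γ) - r γ := by funext γ; ring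
          rw [hA]
          exact h.sub hr_int
        rw [integral_undef hnot, abs_zero]
        exact hε
  · -- `1 ≤ k`
    have heq : (fun γ => (X γ (min m (T γ)) - X γ (min k (T γ))) *
        E.indicator (fun _ => (1 : ℝ)) ((pfx γ).take (k + 1))) =
        fun γ => (∑ t ∈ Finset.Ico (min k (T γ)) (min m (T γ)), Δ γ t) *
          E.indicator (fun _ => (1 : ℝ)) ((pfx γ).take (k + 1)) := by
      funext γ
      rw [tele γ k m hk hkm]
    rw [heq]
    exact (hsum k m hk hkm E).trans (by linarith)

/-! ### Small facts about the hexagonal SAW law -/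

/-- The critical hexagonal SAW law has total mass `≤ 1` (it is `(Z)⁻¹ • weight`, junk `0` when `Z = 0`
or `Z = ∞`). [folklore] -/
theorem hexSAWLaw_univ_le_one (Ω : Set ℂ) (δ : ℝ) (a b : HexVertex) :
    SAW.hexSAWLaw Ω δ a b Set.univ ≤ 1 := by
  simp only [SAW.hexSAWLaw, SAW.embLaw, Measure.smul_apply, smul_eq_mul]
  exact ENNReal.inv_mul_le_one _

/-- Hence it is a finite measure. [folklore] -/
theorem isFiniteMeasure_hexSAWLaw (Ω : Set ℂ) (δ : ℝ) (a b : HexVertex) :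
    IsFiniteMeasure (SAW.hexSAWLaw Ω δ a b) :=
  ⟨lt_of_le_of_lt (hexSAWLaw_univ_le_one Ω δ a b) ENNReal.one_lt_top⟩

/-! ### The composition -/

/-- The COMPOSITION STATEMENT (arrow form): the three stub signatures, verbatim, imply the crux
`Summit.CriticalPhenomena.SAWScalingLimit.Theses.SAWTurnDefect.HexFlowLineMartingale` BY NAME.  (An
`abbrev`, so that the registrar sees exactly one theorem concluding the crux: `HexFlowLineMartingale_of`.) -/
abbrev StubComposition : Prop :=
    (∀ (Ω : Set ℂ) (δ : ℝ) (a b : Literature.Probability.LatticeModels.HexVertex)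
      (γ : Literature.Probability.RandomPlanarGeometry.SAW.HexDomainSAW Ω δ a b)
      (φ : Literature.Probability.RandomPlanarGeometry.ConformalEquiv UpperHalfPlane.upperHalfPlaneSet Ω)
      (l χ : ℝ) (t : ℕ) (y : Literature.Probability.LatticeModels.Site 2),
      1 ≤ t → t + 1 ≤ γ.walk.length →
        γ.igObservable φ l χ (t + 1) y - γ.igObservable φ l χ t y =
          (γ.bank t)ᶜ.indicator (fun _ => (1 : ℝ)) (γ.tipHexagon t) *
            (γ.tipHarmonicMeasure t y *
              (γ.igData φ l χ (t + 1) (γ.tipHexagon t) - γ.igObservable φ l χ t (γ.tipHexagon t)))) →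
    (∀ (l : ℝ) (D : Literature.Probability.RandomPlanarGeometry.DobrushinDomain)
      (a b : ℝ → Literature.Probability.LatticeModels.HexVertex)
      (φ : Literature.Probability.RandomPlanarGeometry.ConformalEquiv UpperHalfPlane.upperHalfPlaneSet D.carrier)
      (z₀ : ℂ) (x : ℝ → Literature.Probability.LatticeModels.Site 2),
      Literature.Probability.RandomPlanarGeometry.SAW.IsEmbEndpointApprox
          Literature.Probability.LatticeModels.hexGraph Literature.Probability.LatticeModels.hexCenter D a b →
      D.IsChordalUniformizing φ → z₀ ∈ D.carrier →
      Filter.Tendsto (fun δ : ℝ => (δ : ℂ) * Literature.Probability.LatticeModels.triEmbed (x δ))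
        (nhdsWithin 0 (Set.Ioi 0)) (nhds z₀) →
      ∀ ρ ε : ℝ, 0 < ρ → 0 < ε → ∀ᶠ δ : ℝ in nhdsWithin 0 (Set.Ioi 0),
        ∀ γ : Literature.Probability.RandomPlanarGeometry.SAW.HexDomainSAW D.carrier δ (a δ) (b δ),
          |γ.igObservable φ l (2 / (3 * Real.pi)) (min 1 (γ.stopIndex z₀ (D.pt 1) ρ)) (x δ)
            - γ.igObservable φ l (2 / (3 * Real.pi)) 0 (x δ)| ≤ ε) →
    (∃ l : ℝ, ∀ (D : Literature.Probability.RandomPlanarGeometry.DobrushinDomain)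
      (a b : ℝ → Literature.Probability.LatticeModels.HexVertex)
      (φ : Literature.Probability.RandomPlanarGeometry.ConformalEquiv UpperHalfPlane.upperHalfPlaneSet D.carrier)
      (z₀ : ℂ) (x : ℝ → Literature.Probability.LatticeModels.Site 2),
      Literature.Probability.RandomPlanarGeometry.SAW.IsEmbEndpointApprox
          Literature.Probability.LatticeModels.hexGraph Literature.Probability.LatticeModels.hexCenter D a b →
      D.IsChordalUniformizing φ → z₀ ∈ D.carrier →
      Filter.Tendsto (fun δ : ℝ => (δ : ℂ) * Literature.Probability.LatticeModels.triEmbed (x δ))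
        (nhdsWithin 0 (Set.Ioi 0)) (nhds z₀) →
      ∀ ρ ε : ℝ, 0 < ρ → 0 < ε → ∀ᶠ δ : ℝ in nhdsWithin 0 (Set.Ioi 0),
        ∀ k m : ℕ, 1 ≤ k → k ≤ m → ∀ E : Set (List Literature.Probability.LatticeModels.HexVertex),
          |∫ γ, (∑ t ∈ Finset.Ico (min k (γ.stopIndex z₀ (D.pt 1) ρ)) (min m (γ.stopIndex z₀ (D.pt 1) ρ)),
                  (γ.bank t)ᶜ.indicator (fun _ => (1 : ℝ)) (γ.tipHexagon t) *
                    (γ.tipHarmonicMeasure t (x δ) *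
                      (γ.igData φ l (2 / (3 * Real.pi)) (t + 1) (γ.tipHexagon t)
                        - γ.igObservable φ l (2 / (3 * Real.pi)) t (γ.tipHexagon t))))
              * E.indicator (fun _ => (1 : ℝ)) (γ.walk.support.take (k + 1))
            ∂(Literature.Probability.RandomPlanarGeometry.SAW.hexSAWLaw D.carrier δ (a δ) (b δ))| ≤ ε) →
    Summit.CriticalPhenomena.SAWScalingLimit.Theses.SAWTurnDefect.HexFlowLineMartingale

/-- COMPOSITION (kernel-checked, no `sorry`): stub signatures → crux.  Take `l` from the kernel
comparison; given the data and `ρ, ε > 0`, intersect the eventual sets of STUB 2 and STUB 3 at `ε/2`;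
at such a `δ` apply `approxMartingale_of_telescoping` to the law `hexSAWLaw` (mass `≤ 1`, discrete
σ-algebra), with `X_t = M_t(x_δ)`, `Δ_t` the defect, `T` the stopping index (`T ≤ |γ|`, so STUB 1
applies for `1 ≤ t < T`). The conclusion is the crux by `ζ/δ`-unfolding (`crux_iff_named`). -/
theorem stubComposition : StubComposition := by
  intro h1 h2 h3
  obtain ⟨l, hl⟩ := h3
  refine ⟨l, ?_⟩
  intro D a b φ z₀ x happ hφ hz₀ hx ρ ε hρ hε
  filter_upwards [h2 l D a b φ z₀ x happ hφ hz₀ hx ρ (ε / 2) hρ (half_pos hε),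
    hl D a b φ z₀ x happ hφ hz₀ hx ρ (ε / 2) hρ (half_pos hε)] with δ hδ2 hδ3
  haveI : IsFiniteMeasure (SAW.hexSAWLaw D.carrier δ (a δ) (b δ)) :=
    isFiniteMeasure_hexSAWLaw D.carrier δ (a δ) (b δ)
  have key := approxMartingale_of_telescoping (SAW.hexSAWLaw D.carrier δ (a δ) (b δ))
    (hexSAWLaw_univ_le_one D.carrier δ (a δ) (b δ))
    (fun f => SAW.EmbDomainSAW.measurable_of_top f)
    (fun γ => γ.walk.support)
    (fun γ t => γ.igObservable φ l (2 / (3 * Real.pi)) t (x δ))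
    (fun γ t => (γ.bank t)ᶜ.indicator (fun _ => (1 : ℝ)) (γ.tipHexagon t) *
      (γ.tipHarmonicMeasure t (x δ) *
        (γ.igData φ l (2 / (3 * Real.pi)) (t + 1) (γ.tipHexagon t)
          - γ.igObservable φ l (2 / (3 * Real.pi)) t (γ.tipHexagon t))))
    (fun γ => γ.stopIndex z₀ (D.pt 1) ρ) hε.le
    (fun γ t h1t htT => h1 D.carrier δ (a δ) (b δ) γ φ l (2 / (3 * Real.pi)) t (x δ) h1t
      (lt_of_lt_of_le htT (γ.stopIndex_le_length z₀ (D.pt 1) ρ)))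
    hδ2 hδ3
  exact key

/-- THE SKELETON THEOREM: the crux
`Summit.CriticalPhenomena.SAWScalingLimit.Theses.SAWTurnDefect.HexFlowLineMartingale` BY NAME, from the
three declared stubs BY NAME (no hypotheses; `sorry` only inside `stub_*`). -/
theorem HexFlowLineMartingale_of :
    Summit.CriticalPhenomena.SAWScalingLimit.Theses.SAWTurnDefect.HexFlowLineMartingale :=
  stubComposition stub_defectStep stub_firstStep stub_kernelComparison

end Summit.CriticalPhenomena.SAWScalingLimit.Cruxes.HexFlowLineMartingale.Birth
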